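import Literature.Geometry.Lorentzian.CoordCylinderDeformationPointwise
import HarnessLib

/-!
# Replacing the second fundamental form of a `C`-normal cylinder family in coordinates:
# the pointwise estimate (Bär–Hanke 2023, §3, Prop. 26)

Coordinate tensor calculus (`CoordCurvature.lean` ff.), a brick (K4B of the notes) of the proof
of the named fact `Literature.Geometry.Riemannian.BarHanke2023_thm27_umbilicNormalForm`. For the
slices of a generalized cylinder with components `Q = γ_t` the scalar curvature is (Bär–Hanke (9),
printed form, in coordinates)

  `𝒮 = scalAt Q x + 3 |½γ̇|² − (tr ½γ̇)² − tr_{γ_t} γ̈_t`.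

In the proof of Prop. 26 (arXiv:2012.09127, pp. 12–13) the family is
`γ_t = (1 − Ct²) g₀ − 2t h + 2 χ_δ(t) (h − k)` ((15)), so that
`γ̈_t = −2C g₀ + 2 χ̈_δ(t) (h − k)` ((17)) while `γ_t − g₀` is `C²`-small ((18)–(19)) and `γ̇_t`
is bounded ((20)–(21)). The decisive terms are `2C tr_{γ_t} g₀ ≥ 2C(n − ½)` ((23)) and
`−2 χ̈_δ tr_{γ_t}(h − k)`, controlled ((22)) either by the sign `χ̈_δ ≤ 0`, `tr_{g₀}(h − k) ≥ 0`
together with `|χ̈_δ| ‖γ_t − g₀‖ ≲ 1` (for `t ≤ δ`), or by `|χ̈_δ| ≤ c₀` (for `t ≥ δ`). This file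
proves the resulting **pointwise inequality** with explicit constants:

* `stepB_pointwise` — with `A = g₀(·)` (`‖♯_A‖, ‖DA‖, ‖D²A‖ ≤ b`), `‖Q − A‖_{C²} ≤ d` at `x`
  (`b d ≤ ½`, `2 n b³ d ≤ ½`), `‖γ̇‖, ‖W‖ ≤ b` (`W = h − k`), `tr_A W ≥ 0`, and
  `γ̈ = −2C A(x) + 2τ₂ W` where either `τ₂ ≤ 0 ∧ |τ₂| ‖Q(x) − A(x)‖ ≤ L` or `|τ₂| ≤ c₀`:
  `𝒮(Q) ≥ 2C (n − ½) − 2042 n² b⁵ − 4 n b³ (L + c₀)`.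

Everything is proved; no definitions, no named facts (D-0026).

## References

* C. Bär, B. Hanke, *Boundary conditions for scalar curvature*, arXiv:2012.09127, §3, Prop. 26
  and its proof, (15)–(24), and (9). [BarHanke2023]
* B. Kotschwar, Comm. Anal. Geom. 22 (2014), §1.1 (5)–(8) (the `C²` perturbation estimate).
  [Kotschwar2014]
-/

noncomputable section

set_option maxSynthPendingDepth 3

open Set Filter ContinuousLinearMap Module
open scoped Topology ContDiff RealInnerProductSpace

namespace Literature.Geometry.Lorentzian

namespace MetricCoord

variable {E : Type*} [NormedAddCommGroup E] [InnerProductSpace ℝ E] [FiniteDimensional ℝ E]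
  [CompleteSpace E] {A Q : E → E →L[ℝ] E →L[ℝ] ℝ} {V : Set E} {x : E}

set_option maxHeartbeats 1600000 in
/-- **Pointwise estimate for Prop. 26** (Bär–Hanke 2023, §3, formula (9) in coordinates along the
family (15)). Let `A` (the components of `g₀`) and `Q` (those of `γ_t`) be metric components on
`V ∋ x` with `‖♯_A‖, ‖DA‖, ‖D²A‖ ≤ b` and `‖Q − A‖, ‖DQ − DA‖, ‖D²Q − D²A‖ ≤ d` at `x`, where
`b d ≤ ½` and `2 n b³ d ≤ ½`; let `hh` (`= γ̇_t(x)`) and `W` (`= (h − k)(x)`) have norm `≤ b`,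
`tr_A W ≥ 0`, and let the second time derivative be `−2C A(x) + 2τ₂ W` with `C ≥ 0` and either
`τ₂ ≤ 0`, `|τ₂| ‖Q(x) − A(x)‖ ≤ L`, or `|τ₂| ≤ c₀`. Then
`scalAt Q x + 3|½hh|²_Q − (tr_Q ½hh)² − tr_Q(−2C A(x) + 2τ₂ W) ≥ 2C(n − ½) − 2042 n² b⁵ − 4 n b³ (L + c₀)`.
[cite: BarHanke2023, §3, Prop. 26, (17)–(24)] -/
theorem stepB_pointwise (hA : IsMetricOn A V) (hQ : IsMetricOn Q V) (hx : x ∈ V)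
    {b d C c₀ L τ₂ : ℝ} (hb : 1 ≤ b) (hd0 : 0 ≤ d) (hC : 0 ≤ C) (hc₀ : 0 ≤ c₀) (hL : 0 ≤ L)
    (hbd : b * d ≤ 2⁻¹) (hnd : 2 * Module.finrank ℝ E * b ^ 3 * d ≤ 2⁻¹)
    (hs : ‖sharpAt A x‖ ≤ b) (h1 : ‖fderiv ℝ A x‖ ≤ b) (h2 : ‖fderiv ℝ (fderiv ℝ A) x‖ ≤ b)
    (hd₀ : ‖Q x - A x‖ ≤ d) (hd₁ : ‖fderiv ℝ Q x - fderiv ℝ A x‖ ≤ d)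
    (hd₂ : ‖fderiv ℝ (fderiv ℝ Q) x - fderiv ℝ (fderiv ℝ A) x‖ ≤ d)
    {hh W : E →L[ℝ] E →L[ℝ] ℝ} (hhh : ‖hh‖ ≤ b) (hW : ‖W‖ ≤ b) (htrW : 0 ≤ mtrAt A x W)
    (hcase : (τ₂ ≤ 0 ∧ |τ₂| * ‖Q x - A x‖ ≤ L) ∨ |τ₂| ≤ c₀) :
    2 * C * (Module.finrank ℝ E - 2⁻¹) - 2042 * (Module.finrank ℝ E) ^ 2 * b ^ 5
        - 4 * Module.finrank ℝ E * b ^ 3 * (L + c₀) ≤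
      scalAt Q x + 3 * normSqAt Q x ((2⁻¹ : ℝ) • hh) - mtrAt Q x ((2⁻¹ : ℝ) • hh) ^ 2
        - mtrAt Q x ((-(2 * C)) • A x + (2 * τ₂) • W) := by
  -- abbreviations and signs
  set n : ℝ := (Module.finrank ℝ E : ℝ) with hn
  have hn0 : 0 ≤ n := Nat.cast_nonneg _
  have hn1 : n ≤ n ^ 2 := by
    rcases Nat.eq_zero_or_pos (Module.finrank ℝ E) with h0 | hpos
    · simp [hn, h0]
    · have : (1 : ℝ) ≤ n := by rw [hn]; exact_mod_cast hpos
      nlinarith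
  have hb0 : 0 ≤ b := zero_le_one.trans hb
  have hb1 : 1 ≤ b ^ 2 := one_le_pow₀ hb
  have hbb : b ≤ b ^ 2 := by nlinarith
  have hb23 : b ^ 2 ≤ b ^ 3 := by nlinarith
  have hb34 : b ^ 3 ≤ b ^ 4 := by nlinarith
  have hb45 : b ^ 4 ≤ b ^ 5 := by nlinarith
  have hiA : (A x).IsInvertible := hA.isInvertible x hx
  have hiQ : (Q x).IsInvertible := hQ.isInvertible x hx
  have hd2 : d ≤ 2⁻¹ := by nlinarith
  have hdb : d ≤ b := by linarith
  -- (a) the inverse metrics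
  have hsQ : ‖sharpAt Q x‖ ≤ 2 * b := by
    have hsmall : ‖sharpAt A x‖ * ‖A x - Q x‖ ≤ 2⁻¹ := by
      rw [norm_sub_rev]
      calc ‖sharpAt A x‖ * ‖Q x - A x‖ ≤ b * d := by gcongr
        _ ≤ 2⁻¹ := hbd
    exact (norm_sharpAt_le_two_mul_of_small hiA hiQ hsmall).trans (by linarith)
  have hsQA : ‖sharpAt Q x - sharpAt A x‖ ≤ 2 * b ^ 2 * ‖Q x - A x‖ := by
    calc ‖sharpAt Q x - sharpAt A x‖ ≤ ‖sharpAt Q x‖ * ‖Q x - A x‖ * ‖sharpAt A x‖ :=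
          norm_sharpAt_sub_le hiQ hiA
      _ ≤ (2 * b) * ‖Q x - A x‖ * b := by gcongr
      _ = 2 * b ^ 2 * ‖Q x - A x‖ := by ring
  have hsQA' : ‖sharpAt Q x - sharpAt A x‖ ≤ 2 * b ^ 2 * d :=
    hsQA.trans (by gcongr)
  -- (b) the Ricci forms and the scalar curvatures
  have hN : (1 : ℝ) ≤ 2 * b := by linarith
  have h1Q : ‖fderiv ℝ Q x‖ ≤ 2 * b := by
    have h := norm_le_insert' (fderiv ℝ Q x) (fderiv ℝ A x)
    linarith
  have h2Q : ‖fderiv ℝ (fderiv ℝ Q) x‖ ≤ 2 * b := by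
    have h := norm_le_insert' (fderiv ℝ (fderiv ℝ Q) x) (fderiv ℝ (fderiv ℝ A) x)
    linarith
  have hricA : ‖ricAt A x‖ ≤ 11 * n * b ^ 4 := opNorm_ricAt_le hA hx hb hs h1 h2
  have hricQA : ‖ricAt Q x - ricAt A x‖ ≤ 2016 * n * b ^ 5 * d := by
    have h := opNorm_ricAt_sub_le hQ hA hx hN hsQ (hs.trans (by linarith)) h1Q
      (h1.trans (by linarith)) h2Q
    calc ‖ricAt Q x - ricAt A x‖
        ≤ 21 * n * (2 * b) ^ 5 * (‖Q x - A x‖ + ‖fderiv ℝ Q x - fderiv ℝ A x‖ +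
            ‖fderiv ℝ (fderiv ℝ Q) x - fderiv ℝ (fderiv ℝ A) x‖) := h
      _ ≤ 21 * n * (2 * b) ^ 5 * (d + d + d) := by gcongr
      _ = 2016 * n * b ^ 5 * d := by ring
  have hb5d : b ^ 5 * d ≤ 2⁻¹ * b ^ 4 := by
    calc b ^ 5 * d = b ^ 4 * (b * d) := by ring
      _ ≤ b ^ 4 * 2⁻¹ := by gcongr
      _ = 2⁻¹ * b ^ 4 := by ring
  have hricQ : ‖ricAt Q x‖ ≤ 1019 * n * b ^ 4 := by
    have h := norm_le_insert' (ricAt Q x) (ricAt A x)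
    have : 2016 * n * b ^ 5 * d ≤ 1008 * n * b ^ 4 := by
      calc 2016 * n * b ^ 5 * d = 2016 * n * (b ^ 5 * d) := by ring
        _ ≤ 2016 * n * (2⁻¹ * b ^ 4) := by gcongr
        _ = 1008 * n * b ^ 4 := by ring
    linarith
  have hscalQA : |scalAt Q x - scalAt A x| ≤ 2027 * n ^ 2 * b ^ 5 := by
    unfold scalAt
    calc |mtrAt Q x (ricAt Q x) - mtrAt A x (ricAt A x)|
        ≤ n * (‖sharpAt Q x - sharpAt A x‖ * ‖ricAt Q x‖ +
            ‖sharpAt A x‖ * ‖ricAt Q x - ricAt A x‖) := abs_mtrAt_sub_mtrAt_le Q A x _ _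
      _ ≤ n * ((2 * b ^ 2 * d) * (1019 * n * b ^ 4) + b * (2016 * n * b ^ 5 * d)) := by gcongr
      _ = 4054 * n ^ 2 * b * (b ^ 5 * d) := by ring
      _ ≤ 4054 * n ^ 2 * b * (2⁻¹ * b ^ 4) := by gcongr
      _ = 2027 * n ^ 2 * b ^ 5 := by ring
  have hscalA : |scalAt A x| ≤ 11 * n ^ 2 * b ^ 5 := by
    unfold scalAt
    calc |mtrAt A x (ricAt A x)| ≤ n * (‖sharpAt A x‖ * ‖ricAt A x‖) := abs_mtrAt_le A x _
      _ ≤ n * (b * (11 * n * b ^ 4)) := by gcongr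
      _ = 11 * n ^ 2 * b ^ 5 := by ring
  have hscalQ : -(2038 * n ^ 2 * b ^ 5) ≤ scalAt Q x := by
    have ha := (abs_le.1 hscalQA).1
    have hb' := (abs_le.1 hscalA).1
    linarith
  -- (c) the first-order terms
  have hβ : ‖(2⁻¹ : ℝ) • hh‖ ≤ 2⁻¹ * b := by
    rw [norm_smul, Real.norm_eq_abs, abs_of_pos (by norm_num)]; gcongr
  have hns : -(3 * n * b ^ 4) ≤ 3 * normSqAt Q x ((2⁻¹ : ℝ) • hh) := by
    have h : |normSqAt Q x ((2⁻¹ : ℝ) • hh)| ≤ n * b ^ 4 := by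
      calc _ ≤ n * (‖sharpAt Q x‖ * ‖(2⁻¹ : ℝ) • hh‖) ^ 2 := abs_normSqAt_le Q x _
        _ ≤ n * ((2 * b) * (2⁻¹ * b)) ^ 2 := by gcongr
        _ = n * b ^ 4 := by ring
    have := (abs_le.1 h).1
    linarith
  have hm : |mtrAt Q x ((2⁻¹ : ℝ) • hh)| ≤ n * b ^ 2 := by
    calc _ ≤ n * (‖sharpAt Q x‖ * ‖(2⁻¹ : ℝ) • hh‖) := abs_mtrAt_le Q x _
      _ ≤ n * ((2 * b) * (2⁻¹ * b)) := by gcongr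
      _ = n * b ^ 2 := by ring
  have hmsq : mtrAt Q x ((2⁻¹ : ℝ) • hh) ^ 2 ≤ n ^ 2 * b ^ 4 := by
    have h0 : 0 ≤ n * b ^ 2 := by positivity
    calc mtrAt Q x ((2⁻¹ : ℝ) • hh) ^ 2 = |mtrAt Q x ((2⁻¹ : ℝ) • hh)| ^ 2 := (sq_abs _).symm
      _ ≤ (n * b ^ 2) ^ 2 := pow_le_pow_left₀ (abs_nonneg _) hm 2
      _ = n ^ 2 * b ^ 4 := by ring
  -- (d) the second-order term: `2C tr_Q A(x) ≥ 2C(n - ½)`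
  have htrA : n - 2⁻¹ ≤ mtrAt Q x (A x) := by
    have hsplit : mtrAt Q x (A x) = mtrAt Q x (Q x) + mtrAt Q x (A x - Q x) := by
      rw [← mtrAt_add]; congr 1; abel
    have hself : mtrAt Q x (Q x) = n := mtrAt_self hiQ
    have hrest : |mtrAt Q x (A x - Q x)| ≤ 2⁻¹ := by
      calc |mtrAt Q x (A x - Q x)| ≤ n * (‖sharpAt Q x‖ * ‖A x - Q x‖) := abs_mtrAt_le Q x _
        _ ≤ n * ((2 * b) * d) := by rw [norm_sub_rev]; gcongr
        _ = 2 * n * b * d := by ring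
        _ ≤ 2 * n * b ^ 3 * d := by
            have : b ≤ b ^ 3 := hbb.trans hb23
            have hnd0 : 0 ≤ 2 * n := by positivity
            nlinarith [mul_nonneg hnd0 hd0]
        _ ≤ 2⁻¹ := hnd
    have := (abs_le.1 hrest).1
    linarith
  have htrA' : 2 * C * (n - 2⁻¹) ≤ 2 * C * mtrAt Q x (A x) := by gcongr
  -- and `-2τ₂ tr_Q W ≥ -4 n b³ L - 4 c₀ n b²`
  have htrW' : -(4 * n * b ^ 3 * L) - 4 * c₀ * n * b ^ 2 ≤ -(2 * τ₂ * mtrAt Q x W) := by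
    have hL' : 0 ≤ 4 * n * b ^ 3 * L := by positivity
    have hc' : 0 ≤ 4 * c₀ * n * b ^ 2 := by positivity
    rcases hcase with ⟨hτ0, hτL⟩ | hτc
    · -- sign case
      have hdiff : |mtrAt Q x W - mtrAt A x W| ≤ 2 * n * b ^ 3 * ‖Q x - A x‖ := by
        calc _ ≤ n * (‖sharpAt Q x - sharpAt A x‖ * ‖W‖ + ‖sharpAt A x‖ * ‖W - W‖) :=
            abs_mtrAt_sub_mtrAt_le Q A x _ _
          _ = n * (‖sharpAt Q x - sharpAt A x‖ * ‖W‖) := by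
              rw [sub_self, norm_zero, mul_zero, add_zero]
          _ ≤ n * ((2 * b ^ 2 * ‖Q x - A x‖) * b) := by gcongr
          _ = 2 * n * b ^ 3 * ‖Q x - A x‖ := by ring
      have hlow : -(2 * n * b ^ 3 * ‖Q x - A x‖) ≤ mtrAt Q x W := by
        have := (abs_le.1 hdiff).1
        linarith
      have habs : |τ₂| = -τ₂ := abs_of_nonpos hτ0
      have hkey : -τ₂ * (-(2 * n * b ^ 3 * ‖Q x - A x‖)) ≤ -τ₂ * mtrAt Q x W :=
        mul_le_mul_of_nonneg_left hlow (by linarith)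
      have hbound : -τ₂ * (2 * n * b ^ 3 * ‖Q x - A x‖) ≤ 2 * n * b ^ 3 * L := by
        calc -τ₂ * (2 * n * b ^ 3 * ‖Q x - A x‖) = 2 * n * b ^ 3 * (|τ₂| * ‖Q x - A x‖) := by
              rw [habs]; ring
          _ ≤ 2 * n * b ^ 3 * L := by gcongr
      nlinarith
    · -- bounded case
      have habs : |2 * τ₂ * mtrAt Q x W| ≤ 4 * c₀ * n * b ^ 2 := by
        rw [abs_mul, abs_mul, abs_of_pos (by norm_num : (0 : ℝ) < 2)]
        calc 2 * |τ₂| * |mtrAt Q x W| ≤ 2 * c₀ * (n * (‖sharpAt Q x‖ * ‖W‖)) := by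
              gcongr
              exact abs_mtrAt_le Q x W
          _ ≤ 2 * c₀ * (n * ((2 * b) * b)) := by gcongr
          _ = 4 * c₀ * n * b ^ 2 := by ring
      have := (abs_le.1 habs).2
      linarith
  have hsecond : 2 * C * (n - 2⁻¹) - 4 * n * b ^ 3 * L - 4 * c₀ * n * b ^ 2 ≤
      -mtrAt Q x ((-(2 * C)) • A x + (2 * τ₂) • W) := by
    rw [mtrAt_add, mtrAt_smul, mtrAt_smul]
    linarith
  -- (e) collecting
  have hk1 : 3 * n * b ^ 4 ≤ 3 * n ^ 2 * b ^ 5 := by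
    have : n * b ^ 4 ≤ n ^ 2 * b ^ 5 :=
      mul_le_mul hn1 hb45 (by positivity) (by positivity)
    linarith
  have hk2 : n ^ 2 * b ^ 4 ≤ n ^ 2 * b ^ 5 := by gcongr
  have hk3 : 4 * c₀ * n * b ^ 2 ≤ 4 * n * b ^ 3 * c₀ := by
    have : c₀ * n * b ^ 2 ≤ n * b ^ 3 * c₀ := by
      calc c₀ * n * b ^ 2 = n * b ^ 2 * c₀ := by ring
        _ ≤ n * b ^ 3 * c₀ := by gcongr
    linarith
  linarith [hscalQ, hns, hmsq, hsecond, hk1, hk2, hk3]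

end MetricCoord

end Literature.Geometry.Lorentzian

end
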